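import Summits.KontsevichZagierPeriods.KontsevichZagierPeriods.Theorems.PlanarK0Injective.Negative.Kit

/-!
# `PlanarCompiler` (stmt-KontsevichZagierPeriods-10058) — negative side I: the implication shape,
and the pointwise integrand-`1` hypothesis is used *syntactically*

Refuter (`cdisprove`) by-products for the crux `PlanarCompiler` of route `SymplecticScissors`, on
top of the sibling crux's kit `Theorems/PlanarK0Injective/Negative/Kit.lean` (`planarGens`,
`planarGroup`, unit squares).

* `planarCompiler_iff` — the crux IS the glue `RealOnePeriodRelations → PlanarK0Injective`
  (definitional). Hence `¬ PlanarCompiler ↔ RealOnePeriodRelations ∧ ¬ PlanarK0Injective`: a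
  refutation needs Huber–Wüstholz-in-real-clothes (stmt-10042) AND a curved Dehn invariant
  (stmt-9847); and every hypothesis-dropped compiler is EQUIVALENT to `¬ RealOnePeriodRelations`
  once the corresponding variant of the consequent is refuted (`compilerWithout_iff_not_antecedent`;
  instances: the sibling files' `planarK0Injective_false_without_value_eq`,
  `planarK0Injective_false_without_integrand_one`, `not_planarScissorsOnly`, `not_planarOneMove[Open]`,
  and `not_planarK0InjectiveAE` below).
* `not_planarK0InjectiveAE` — sharpening of the sibling's `planarK0Injective_false_without_integrand_one`:
  even the ALMOST-EVERYWHERE weakening of `∀ p ∈ r.domain, r.integrand p = 1` is false. Witness: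
  the unit square with integrand `2` at its centre only (`bumpSquare`, value `1`); the coefficient
  functional `coeffHom ⟨2, bumpSquare⟩` kills `span planarGens ⊇ planarGroup` but not
  `[bumpSquare] − [(0,1)²]`. So `planarGroup` cannot even MENTION a representation whose integrand is
  `1` only a.e.: the compiler's realisation map `Θ` must output literal integrand-`1` representations.
[Kontsevich–Zagier 2001, §1.2]
-/

noncomputable section

open MeasureTheory Set MvPolynomial
open Literature.NumberTheory.Transcendental Literature.ModelTheory.ExponentialFields
open Summit.KontsevichZagierPeriods.KontsevichZagierPeriods.Theses.SymplecticScissors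

namespace Summit.KontsevichZagierPeriods.SymplecticScissors.PlanarCompilerNegative

open Summit.KontsevichZagierPeriods.SymplecticScissors.PlanarK0InjectiveNegative

/-! ## §1 The implication shape -/

/-- `PlanarCompiler` is literally `RealOnePeriodRelations → PlanarK0Injective` (definitional). [folklore] -/
theorem planarCompiler_iff : PlanarCompiler ↔ (RealOnePeriodRelations → PlanarK0Injective) :=
  Iff.rfl

/-- A hypothesis-dropped compiler is exactly as strong as the negation of the antecedent: if the
weakened consequent `B` is refuted, `(RealOnePeriodRelations → B) ↔ ¬ RealOnePeriodRelations`. [folklore] -/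
theorem compilerWithout_iff_not_antecedent {B : Prop} (hB : ¬ B) :
    (RealOnePeriodRelations → B) ↔ ¬ RealOnePeriodRelations :=
  ⟨fun h hA => hB (h hA), fun h hA => (h hA).elim⟩

/-- Conversely any proof of the consequent closes the crux (the antecedent is then unused). [folklore] -/
theorem planarCompiler_of_planarK0Injective (h : PlanarK0Injective) : PlanarCompiler := fun _ => h

/-! ## §2 The coefficient functional and the bumped square -/

open Classical in
/-- The coefficient functional `χₐ : FormalRep →+ ℤ` of the generator `a`. [folklore] -/
def coeffHom (a : Σ n, KZ.IntegralRep n) : KZ.FormalRep →+ ℤ :=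
  FreeAbelianGroup.lift fun x => if x = a then 1 else 0

open Classical in
/-- `χₐ` on generators. [folklore] -/
@[simp] theorem coeffHom_of (a b : Σ n, KZ.IntegralRep n) :
    coeffHom a (FreeAbelianGroup.of b) = if b = a then 1 else 0 := by
  simp [coeffHom]

open Classical in
/-- `χₐ` on `KZ.of`. [folklore] -/
theorem coeffHom_KZof {n : ℕ} (a : Σ n, KZ.IntegralRep n) (s : KZ.IntegralRep n) :
    coeffHom a (KZ.of s) = if (⟨n, s⟩ : Σ n, KZ.IntegralRep n) = a then 1 else 0 :=
  coeffHom_of a ⟨n, s⟩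

/-- If `r` is not an integrand-1 representation, `χ_r` kills `span planarGens` (hence
`planarGroup`). [folklore] -/
theorem coeffHom_eq_zero_of_mem_span {r : KZ.IntegralRep 2}
    (hr : ¬ ∀ p ∈ r.domain, r.integrand p = 1) {c : KZ.FormalRep}
    (hc : c ∈ AddSubgroup.closure planarGens) : coeffHom ⟨2, r⟩ c = 0 := by
  refine (AddSubgroup.closure_le (K := (coeffHom ⟨2, r⟩).ker)).mpr ?_ hc
  rintro _ ⟨s, hs, rfl⟩
  simp only [SetLike.mem_coe, AddMonoidHom.mem_ker, coeffHom_KZof]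
  split_ifs with h
  · cases h
    exact (hr hs).elim
  · rfl

/-- The centre of the unit square. [folklore] -/
def centre : Fin 2 → ℝ := fun _ => 1 / 2

/-- The centre lies in the open unit square. [folklore] -/
theorem centre_mem : centre ∈ openUnitSquare.domain := by
  rw [mem_openUnitSquare]; norm_num [centre]

/-- `{centre}` is ℚ-semialgebraic. [folklore] -/
theorem isSemialgebraic_singleton_centre : IsSemialgebraic ℚ ({centre} : Set (Fin 2 → ℝ)) := by
  have h := (isSemialgebraic_setOf_eval_eq_zero (k := ℚ) (R := ℝ) (ι := Fin 2)
    (X 0 - C (1 / 2))).inter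
    (isSemialgebraic_setOf_eval_eq_zero (k := ℚ) (R := ℝ) (ι := Fin 2) (X 1 - C (1 / 2)))
  have hEq : ({centre} : Set (Fin 2 → ℝ)) =
      {x : Fin 2 → ℝ | aeval x (X 0 - C (1 / 2) : MvPolynomial (Fin 2) ℚ) = 0} ∩
      {x : Fin 2 → ℝ | aeval x (X 1 - C (1 / 2) : MvPolynomial (Fin 2) ℚ) = 0} := by
    ext p
    simp only [mem_singleton_iff, mem_inter_iff, mem_setOf_eq, map_sub, aeval_X, aeval_C,
      sub_eq_zero, eq_ratCast]
    constructor
    · rintro rfl; norm_num [centre]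
    · rintro ⟨h0, h1⟩
      ext i; fin_cases i
      · simpa [centre] using h0
      · simpa [centre] using h1
  rw [hEq]; exact h

/-- The bumped integrand: `2` at the centre, `1` elsewhere. [folklore] -/
def bump : (Fin 2 → ℝ) → ℝ := fun p => if p = centre then 2 else 1

/-- `bump` is ℚ-semialgebraic on the unit square (glue the graph of `1` over the punctured square
with the point `(centre, 2)`). [folklore] -/
theorem isSemialgebraicFunOn_bump : IsSemialgebraicFunOn ℚ openUnitSquare.domain bump := by
  classical
  have h1 : IsSemialgebraicFunOn ℚ (openUnitSquare.domain \ {centre}) bump := by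
    refine (isSemialgebraicFunOn_aeval (openUnitSquare.isSemialgebraic_domain.diff
      isSemialgebraic_singleton_centre) (C 1 : MvPolynomial (Fin 2) ℚ)).congr ?_
    intro p hp
    have : p ≠ centre := fun h => hp.2 (by simp [h])
    simp [bump, this]
  have h2 : IsSemialgebraicFunOn ℚ ({centre} : Set (Fin 2 → ℝ)) bump := by
    refine (isSemialgebraicFunOn_aeval isSemialgebraic_singleton_centre
      (C 2 : MvPolynomial (Fin 2) ℚ)).congr ?_
    intro p hp
    rw [mem_singleton_iff] at hp
    simp [bump, hp]
  unfold IsSemialgebraicFunOn at h1 h2 ⊢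
  convert h1.union h2 using 1
  ext z
  simp only [mem_setOf_eq, mem_union]
  constructor
  · rintro ⟨x, hx, rfl⟩
    by_cases hxc : x = centre
    · exact Or.inr ⟨x, hxc, rfl⟩
    · exact Or.inl ⟨x, ⟨hx, hxc⟩, rfl⟩
  · rintro (⟨x, ⟨hx, -⟩, rfl⟩ | ⟨x, rfl, rfl⟩)
    · exact ⟨x, hx, rfl⟩
    · exact ⟨centre, centre_mem, rfl⟩

/-- `bump = 1` almost everywhere on the square. [folklore] -/
theorem bump_ae_eq_one : bump =ᵐ[volume.restrict openUnitSquare.domain] fun _ => 1 := by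
  have hnull : volume ({centre} : Set (Fin 2 → ℝ)) = 0 := measure_singleton centre
  have : ∀ᵐ p ∂(volume : Measure (Fin 2 → ℝ)), p ≠ centre := by
    rw [ae_iff]; simp [hnull]
  refine ae_restrict_of_ae ?_
  filter_upwards [this] with p hp
  simp [bump, hp]

/-- `[(0,1)², bump]`: value `1`, integrand `1` only almost everywhere. [folklore] -/
def bumpSquare : KZ.IntegralRep 2 where
  domain := openUnitSquare.domain
  integrand := bump
  isSemialgebraic_domain := openUnitSquare.isSemialgebraic_domain
  isSemialgebraicFunOn_integrand := isSemialgebraicFunOn_bump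
  integrableOn := openUnitSquare.integrableOn.congr_fun_ae bump_ae_eq_one.symm

/-- `value bumpSquare = 1`. [folklore] -/
theorem value_bumpSquare : bumpSquare.value = 1 := by
  have : bumpSquare.value = openUnitSquare.value := by
    simp only [KZ.IntegralRep.value]
    exact integral_congr_ae bump_ae_eq_one
  rw [this, value_openUnitSquare]

/-- `bumpSquare` is NOT a planar generator. [folklore] -/
theorem bumpSquare_not_planar : ¬ ∀ p ∈ bumpSquare.domain, bumpSquare.integrand p = 1 := by
  intro h
  have := h centre centre_mem
  norm_num [bumpSquare, bump] at this

/-- … but its integrand is `1` almost everywhere on its domain. [folklore] -/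
theorem bumpSquare_ae_one :
    ∀ᵐ p ∂(volume.restrict bumpSquare.domain), bumpSquare.integrand p = 1 :=
  bump_ae_eq_one

/-! ## §3 The a.e. weakening of the integrand hypothesis is false -/

/-- `PlanarK0Injective` with `∀ p ∈ r.domain, r.integrand p = 1` weakened to "almost everywhere"
(stated only to be negated). -/
def PlanarK0InjectiveAE : Prop :=
  ∀ r r' : KZ.IntegralRep 2, (∀ᵐ p ∂(volume.restrict r.domain), r.integrand p = 1) →
    (∀ p ∈ r'.domain, r'.integrand p = 1) → r.value = r'.value →
    KZ.of r - KZ.of r' ∈ planarGroup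

/-- LOAD-BEARING (pointwise integrand `1`, used SYNTACTICALLY): `PlanarK0InjectiveAE` is false —
`planarGroup ≤ span planarGens` cannot see `bumpSquare` at all. [folklore] -/
theorem not_planarK0InjectiveAE : ¬ PlanarK0InjectiveAE := by
  intro h
  -- `planarGroup ≤ span planarGens` (= `planarGroup_le_closure_planarGens` of the sibling
  -- `PlanarK0Injective/Negative/LoadBearing.lean`, inlined to keep this file's imports to the kit)
  have hle : planarGroup ≤ AddSubgroup.closure planarGens :=
    (AddSubgroup.closure_le _).mpr fun _ hc => hc.2
  have hmem := hle
    (h bumpSquare openUnitSquare bumpSquare_ae_one (fun _ _ => rfl)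
      (value_bumpSquare.trans value_openUnitSquare.symm))
  have h0 := coeffHom_eq_zero_of_mem_span bumpSquare_not_planar hmem
  rw [map_sub, coeffHom_KZof, coeffHom_KZof, if_pos rfl, if_neg] at h0
  · norm_num at h0
  · intro hEq
    have hru : openUnitSquare = bumpSquare := eq_of_heq (Sigma.mk.inj_iff.mp hEq).2
    exact bumpSquare_not_planar (hru ▸ fun _ _ => rfl)

/-- Hence the a.e.-compiler would refute Huber–Wüstholz-in-real-clothes. [folklore] -/
theorem planarCompilerAE_iff :
    (RealOnePeriodRelations → PlanarK0InjectiveAE) ↔ ¬ RealOnePeriodRelations :=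
  compilerWithout_iff_not_antecedent not_planarK0InjectiveAE

end Summit.KontsevichZagierPeriods.SymplecticScissors.PlanarCompilerNegative
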